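import Literature.Analysis.FluidPDE.OseenMildWindowRepresentative
import Literature.Analysis.FluidPDE.AncientMildRepresentative
import Literature.Analysis.FluidPDE.KNSSLiouvilleBridge
import Literature.Analysis.FluidPDE.TypeIRateOseenMildRepresentative
import Literature.Analysis.FluidPDE.SelfSimilar
import HarnessLib

/-!
# Crux `HubbleDynamo.NoSelfExcitedDynamo` (stmt-NavierStokesRegularity-1934), line `registered`:
# stub `stub_oseenRepresentative` — continuous Oseen-mild representatives of Type I ancient solutions

Helper file (`--supports stmt-NavierStokesRegularity-1934`; theorems only, sorry-free). A bounded
ancient mild solution `u` of Navier–Stokes (`ν = 1`, the tree's duality form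
`IsBoundedAncientMildSolution 1 u`) with measurable slices and the pointwise Type I bound
`‖u(t, x)‖ ≤ C / (‖x‖ + √(−t))` admits a representative `v`, continuous on the open past
`(−∞, 0) × ℝ³`, bounded, with weakly divergence-free slices at every `t < 0`, solving the Oseen
integral equation `v(t) = e^{(t−s)Δ}v(s) − B¹ₛ(v, v)(t)` pointwise for all `s < t < 0`, and equal
to `u(t)` a.e. in space for a.e. `t < 0` (KNSS 2009, §4 (i): the honest bounded mild
representative, free of the parasitic drift `b(t)` of §1). Steps (all ingredients are in the tree):
1. the decay gives `r ‖u(t, x)‖ ≤ C`, so the family is weak-* continuous in time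
   (`continuousOn_integral_inner_of_cylRadius_decay`) and has a jointly measurable bounded
   modification `w` in the same class (`exists_stronglyMeasurable_modification`,
   `exists_bounded_modification`, `IsBoundedAncientMildSolution.congr_ae_slice`);
2. mild ⇒ weak in `L^∞` (`IsBoundedAncientMildSolution.isBoundedWeakNSSolutionOn`);
3. on a window (`oseenRep_window`, steps 2–5 of `exists_oseenMild_repr_window` after a time
   shift): KNSS's Lemma 3.1 (`KNSS2009_weak_driftMild_holds`) writes `w = U + b(t)`, the Morrey
   bound `∫_{B_m(0)} ‖u(t)‖² ≤ 4πC²m` (`oseenRep_lintegral_ball_sq_le`) kills the drift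
   (`IsKNSSDriftMild.exists_zeroDrift_of_morrey`), and zero-drift fields are continuous Oseen-mild;
4. glue the windows `(−(n+2), −1/(n+2))` (`oseenRep_ancient`) and return to slices by Fubini.

## References

* G. Koch, N. Nadirashvili, G. Seregin, V. Šverák, Acta Math. 203 (2009) 83–105 =
  arXiv:0709.3599, Lemma 3.1, Remark 3.1, §4 (i)–(ii), (1.6). [KochNadirashviliSereginSverak2009]
* D. Albritton, T. Barker, J. Math. Fluid Mech. 21 (2019) = arXiv:1811.00502, §3.
  [AlbrittonBarker2019]
-/

noncomputable section

-- the registered stub namespace repeats the summit name `NavierStokesRegularity` (summit = problem)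
set_option linter.dupNamespace false

namespace Summit.NavierStokesRegularity.NavierStokesRegularity.Theorems.NoSelfExcitedDynamo.Registered

open Set MeasureTheory Filter Topology Function Metric TopologicalSpace
open scoped ENNReal RealInnerProductSpace
open Literature.Analysis.FluidPDE

/-! ### The Morrey bound from the decay `‖u(t, y)‖ ≤ C / ‖y‖` -/

/-- **The scale-invariant Morrey bound at the origin**: if `‖f(y)‖ ≤ C / ‖y‖` off the origin, then
`∫_{B_m(0)} ‖f‖² ≤ 4πC²m` for every `m > 0` (`‖f‖² ≤ C² · 1_{‖y‖<m} ‖y‖⁻²` a.e. on the ball and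
`∫ 1_{‖y‖<m} ‖y‖⁻² dy = 4πm`, `lintegral_nearProfile₁_norm_sq`). -/
theorem oseenRep_lintegral_ball_sq_le {f : EuclideanSpace ℝ (Fin 3) → EuclideanSpace ℝ (Fin 3)}
    {C : ℝ} (hf : ∀ y, y ≠ 0 → ‖f y‖ ≤ C / ‖y‖) {m : ℝ} (hm : 0 < m) :
    ∫⁻ y in ball (0 : EuclideanSpace ℝ (Fin 3)) m, ‖f y‖ₑ ^ 2 ≤
      ENNReal.ofReal (4 * Real.pi * C ^ 2 * m) := by
  have hne : ∀ᵐ y ∂(volume : Measure (EuclideanSpace ℝ (Fin 3))), y ≠ 0 := by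
    rw [ae_iff]
    have : {y : EuclideanSpace ℝ (Fin 3) | ¬ y ≠ 0} = {0} := by ext y; simp
    rw [this, measure_singleton]
  have hae : ∀ᵐ y ∂(volume.restrict (ball (0 : EuclideanSpace ℝ (Fin 3)) m)),
      ‖f y‖ₑ ^ 2 ≤ ENNReal.ofReal (C ^ 2) * ENNReal.ofReal (nearProfile₁ m ‖y‖) ^ 2 := by
    filter_upwards [ae_restrict_mem measurableSet_ball, ae_restrict_of_ae hne] with y hy hy0
    have hlt : ‖y‖ < m := mem_ball_zero_iff.1 hy
    have h1 : ‖f y‖ ≤ C * ‖y‖⁻¹ := by rw [← div_eq_mul_inv]; exact hf y hy0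
    unfold nearProfile₁
    rw [if_pos hlt, ← ofReal_norm, ← ENNReal.ofReal_pow (norm_nonneg _),
      ← ENNReal.ofReal_pow (inv_nonneg.2 (norm_nonneg _)), ← ENNReal.ofReal_mul (sq_nonneg _)]
    refine ENNReal.ofReal_le_ofReal ?_
    calc ‖f y‖ ^ 2 ≤ (C * ‖y‖⁻¹) ^ 2 := pow_le_pow_left₀ (norm_nonneg _) h1 2
      _ = C ^ 2 * ‖y‖⁻¹ ^ 2 := by ring
  calc ∫⁻ y in ball (0 : EuclideanSpace ℝ (Fin 3)) m, ‖f y‖ₑ ^ 2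
      ≤ ∫⁻ y in ball (0 : EuclideanSpace ℝ (Fin 3)) m,
          ENNReal.ofReal (C ^ 2) * ENNReal.ofReal (nearProfile₁ m ‖y‖) ^ 2 :=
        lintegral_mono_ae hae
    _ ≤ ∫⁻ y, ENNReal.ofReal (C ^ 2) * ENNReal.ofReal (nearProfile₁ m ‖y‖) ^ 2 :=
        setLIntegral_le_lintegral _ _
    _ = ENNReal.ofReal (C ^ 2) * ENNReal.ofReal (4 * Real.pi * m) := by
        rw [lintegral_const_mul' _ _ ENNReal.ofReal_ne_top, lintegral_nearProfile₁_norm_sq hm]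
    _ = ENNReal.ofReal (4 * Real.pi * C ^ 2 * m) := by
        rw [← ENNReal.ofReal_mul (sq_nonneg _)]
        congr 1
        ring

/-! ### The window representative of a bounded weak solution with the Morrey bound -/

/-- **Continuous Oseen-mild representative of a bounded weak solution with the Morrey bound, on a
window** (KNSS 2009, Lemma 3.1 and §4 (i); steps 2–5 of `exists_oseenMild_repr_window`, its step 1
replaced by a time shift of the hypothesis). For `u` bounded weak (`ν = 1`) on `(a, c) × ℝ³` with
`‖u‖ ≤ M` there and `∫_{B_m(0)} ‖u(t)‖² ≤ I m` for all integers `m ≥ m₀` and all `t ∈ (a, c)`,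
there is `v`, continuous on `(a, c) × ℝ³`, with weakly divergence-free slices at every
`t ∈ (a, c)`, solving `v(t, x) = e^{(t−s)Δ}v(s)(x) − B¹ₛ(v, v)(t)(x)` for `a < s < t < c`, and
equal to `u` almost everywhere on `(a, c) × ℝ³`. -/
theorem oseenRep_window {u : ℝ → EuclideanSpace ℝ (Fin 3) → EuclideanSpace ℝ (Fin 3)} {a c : ℝ}
    (hac : a < c) (hw : IsBoundedWeakNSSolutionOn (Ioo a c) isOpen_Ioo 1 u)
    {M : ℝ} (hM : ∀ t ∈ Ioo a c, ∀ x, ‖u t x‖ ≤ M) {I : ℝ} (hI : 0 ≤ I) {m₀ : ℕ}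
    (hMor : ∀ t ∈ Ioo a c, ∀ m : ℕ, m₀ ≤ m →
      ∫⁻ y in ball (0 : EuclideanSpace ℝ (Fin 3)) m, ‖u t y‖ₑ ^ 2 ≤ ENNReal.ofReal (I * m)) :
    ∃ v : ℝ → EuclideanSpace ℝ (Fin 3) → EuclideanSpace ℝ (Fin 3),
      ContinuousOn (uncurry v) (Ioo a c ×ˢ univ) ∧
      (∀ t ∈ Ioo a c, IsWeaklyDivFree (v t)) ∧
      (∀ s t : ℝ, a < s → s < t → t < c → ∀ x,
        v t x = Literature.Analysis.UnboundedOperators.heatExtension (v s) (t - s) x -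
          oseenDuhamel 1 s v v t x) ∧
      (∀ᵐ z ∂(volume.restrict (Ioo a c ×ˢ (univ : Set (EuclideanSpace ℝ (Fin 3))))),
        uncurry u z = uncurry v z) := by
  set T : ℝ := c - a with hT
  have hT0 : 0 < T := sub_pos.2 hac
  have hwin : ∀ {τ : ℝ}, τ ∈ Ioo 0 T → τ + a ∈ Ioo a c := fun hτ =>
    ⟨by linarith [hτ.1], by rw [hT] at hτ; linarith [hτ.2]⟩
  -- ## Step 1: the translate `u(· + a)` is a bounded weak solution on `(0, T)`
  set ua : ℝ → EuclideanSpace ℝ (Fin 3) → EuclideanSpace ℝ (Fin 3) := fun s => u (s + a) with hua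
  have hbw : IsBoundedWeakNSSolutionOn (Ioo 0 T) isOpen_Ioo 1 ua :=
    hw.comp_add_right a isOpen_Ioo fun t =>
      ⟨hwin, fun ht => ⟨by linarith [ht.1], by rw [hT]; linarith [ht.2]⟩⟩
  have hMa : ∀ s ∈ Ioo 0 T, ∀ y, ‖ua s y‖ ≤ M := fun s hs' y => hM (s + a) (hwin hs') y
  -- ## Step 2: Lemma 3.1
  obtain ⟨N, hN⟩ := KNSS2009_weak_driftMild_holds M T hT0
  obtain ⟨U, b, hUb, hae⟩ := hN hbw hMa
  -- ## Step 3: the Morrey bound, transported to `U + b`, kills the drift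
  have hMor' : ∀ᵐ τ ∂(volume.restrict (Ioo 0 T)), ∀ m : ℕ, m₀ ≤ m →
      ∫⁻ y in ball (0 : EuclideanSpace ℝ (Fin 3)) m, ‖U τ y + b τ‖ₑ ^ 2 ≤ ENNReal.ofReal (I * m) := by
    filter_upwards [hae, ae_restrict_mem measurableSet_Ioo] with τ hτae hτI m hm
    have e : ∫⁻ y in ball (0 : EuclideanSpace ℝ (Fin 3)) m, ‖U τ y + b τ‖ₑ ^ 2 =
        ∫⁻ y in ball (0 : EuclideanSpace ℝ (Fin 3)) m, ‖ua τ y‖ₑ ^ 2 :=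
      lintegral_congr_ae (ae_restrict_of_ae (hτae.mono fun y hy => by
        show ‖U τ y + b τ‖ₑ ^ 2 = ‖ua τ y‖ₑ ^ 2
        rw [hy]))
    rw [e]
    exact hMor (τ + a) (hwin hτI) m hm
  obtain ⟨V, hV, hVae⟩ := hUb.exists_zeroDrift_of_morrey hI hMor'
  -- `ua(τ) = V(τ)` a.e. in space for a.e. `τ`, hence a.e. on the strip
  have hslice : ∀ᵐ τ ∂(volume.restrict (Ioo 0 T)), ua τ =ᵐ[volume] V τ := by
    filter_upwards [hae, hVae] with τ h1 h2
    exact h1.mono fun y hy => by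
      show ua τ y = V τ y
      rw [hy]
      exact h2 y
  have hstrip : uncurry ua =ᵐ[volume.restrict (Ioo 0 T ×ˢ univ)] uncurry V := by
    have hm1 : AEStronglyMeasurable (uncurry ua)
        (((volume : Measure ℝ).restrict (Ioo 0 T)).prod (volume : Measure (EuclideanSpace ℝ (Fin 3)))) := by
      have h := hbw.aestronglyMeasurable
      rwa [volume_restrict_slab_eq] at h
    rw [volume_restrict_slab_eq]
    exact ae_eq_prod_of_ae_slice_ae_eq hm1 hV.measurable.aestronglyMeasurable hslice
  -- ## Steps 4–5: the representative in the original time variable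
  set v : ℝ → EuclideanSpace ℝ (Fin 3) → EuclideanSpace ℝ (Fin 3) := fun t x => V (t - a) x with hv
  refine ⟨v, ?_, ?_, ?_, ?_⟩
  · -- joint continuity
    refine hV.continuousOn_uncurry.comp (f := fun q : ℝ × EuclideanSpace ℝ (Fin 3) => (q.1 - a, q.2))
      ((continuous_fst.sub continuous_const).prodMk continuous_snd).continuousOn ?_
    intro q hq
    exact ⟨⟨sub_pos.2 hq.1.1, by rw [hT]; linarith [hq.1.2]⟩, mem_univ _⟩
  · -- weakly divergence-free slices at every time
    intro t ht
    exact hV.isWeaklyDivFree_of_mem ⟨sub_pos.2 ht.1, by rw [hT]; linarith [ht.2]⟩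
  · -- the Oseen identity
    intro s t has hst htc x
    have h1 := (hV.eq_heatExtension_sub_oseenDuhamel_three (s := s - a) (t := t - a)
      (sub_pos.2 has) (by linarith) (by rw [hT]; linarith)).1 x
    rw [show t - a - (s - a) = t - s by ring] at h1
    show V (t - a) x = Literature.Analysis.UnboundedOperators.heatExtension (V (s - a)) (t - s) x -
      oseenDuhamel 1 s (fun τ => V (τ - a)) (fun τ => V (τ - a)) t x
    rw [oseenDuhamel_comp_sub_right]
    exact h1
  · -- `u = v` a.e. on the strip: transport `hstrip` by `(t, x) ↦ (t − a, x)`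
    have h1 := (ae_restrict_iff' (measurableSet_Ioo.prod MeasurableSet.univ)).1 hstrip
    have hmp : MeasurePreserving (Prod.map (fun t : ℝ => t - a) (@id (EuclideanSpace ℝ (Fin 3)))) volume volume := by
      rw [Measure.volume_eq_prod]
      exact (measurePreserving_sub_right (volume : Measure ℝ) a).prod (MeasurePreserving.id volume)
    refine (ae_restrict_iff' (measurableSet_Ioo.prod MeasurableSet.univ)).2
      ((hmp.quasiMeasurePreserving.ae h1).mono fun z hz hzI => ?_)
    have h3 := hz ⟨⟨show 0 < z.1 - a by linarith [hzI.1.1],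
      show z.1 - a < T by rw [hT]; linarith [hzI.1.2]⟩, mem_univ _⟩
    simp only [uncurry, Prod.map, id, hua, sub_add_cancel] at h3
    simpa only [uncurry, hv] using h3

/-! ### Gluing the windows `(−(n+2), −1/(n+2))` -/

/-- **Bounded weak solutions on the past with the Morrey bound are continuous ancient Oseen-mild
fields** (after `exists_oseenMild_repr_of_typeIBound_lt_top`). For `w` bounded weak (`ν = 1`) on
`(−∞, 0) × ℝ³` with `‖w‖ ≤ K` and `∫_{B_m(0)} ‖w(t)‖² ≤ I m` (`m ≥ 1` integer, `t < 0`), there is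
`v = w` a.e. on the slab, continuous on the open slab, with weakly divergence-free slices at every
`t < 0`, solving `v(t, x) = e^{(t−s)Δ}v(s)(x) − B¹ₛ(v, v)(t)(x)` for all `s < t < 0`, and bounded by
`K` everywhere: the window representatives `v_n` of `oseenRep_window` on `W_n = (−(n+2), −1/(n+2))`
agree on overlaps (continuous and a.e. equal on an open set), so `v(t) = v_{n(t)}(t)` is locally
some `v_n`; the bound passes from `w` (a.e.) to the continuous `v` by the same principle. -/
theorem oseenRep_ancient {w : ℝ → EuclideanSpace ℝ (Fin 3) → EuclideanSpace ℝ (Fin 3)} {K : ℝ}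
    (hweak : IsBoundedWeakNSSolutionOn (Iio 0) isOpen_Iio 1 w)
    (hK : ∀ t < 0, ∀ x, ‖w t x‖ ≤ K) {I : ℝ} (hI : 0 ≤ I)
    (hMor : ∀ t < 0, ∀ m : ℕ, 1 ≤ m →
      ∫⁻ y in ball (0 : EuclideanSpace ℝ (Fin 3)) m, ‖w t y‖ₑ ^ 2 ≤ ENNReal.ofReal (I * m)) :
    ∃ v : ℝ → EuclideanSpace ℝ (Fin 3) → EuclideanSpace ℝ (Fin 3),
      (∀ᵐ z ∂(volume.restrict (Iio (0 : ℝ) ×ˢ (univ : Set (EuclideanSpace ℝ (Fin 3))))),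
        uncurry w z = uncurry v z) ∧
      ContinuousOn (uncurry v) (Iio 0 ×ˢ univ) ∧
      (∀ t < 0, IsWeaklyDivFree (v t)) ∧
      (∀ s t : ℝ, s < t → t < 0 → ∀ x,
        v t x = Literature.Analysis.UnboundedOperators.heatExtension (v s) (t - s) x -
          oseenDuhamel 1 s v v t x) ∧
      (∀ t < 0, ∀ x, ‖v t x‖ ≤ K) := by
  -- ## the windows `W n = (−(n+2), −1/(n+2))`
  set a : ℕ → ℝ := fun n => -((n : ℝ) + 2) with ha
  set c : ℕ → ℝ := fun n => -(1 / ((n : ℝ) + 2)) with hc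
  have hc0 : ∀ n, c n < 0 := fun n => by rw [hc]; dsimp only; rw [neg_lt_zero]; positivity
  have hac : ∀ n, a n < c n := fun n => by
    rw [ha, hc]; dsimp only
    have hn : (2 : ℝ) ≤ (n : ℝ) + 2 := by linarith [(Nat.cast_nonneg n : (0 : ℝ) ≤ n)]
    have h1 : 1 / ((n : ℝ) + 2) ≤ 1 / 2 := div_le_div_of_nonneg_left zero_le_one two_pos hn
    linarith
  have hanti : ∀ {k m : ℕ}, k ≤ m → a m ≤ a k := fun {k m} hkm => by
    rw [ha]; dsimp only
    have : (k : ℝ) ≤ m := by exact_mod_cast hkm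
    linarith
  have hcmono : ∀ {k m : ℕ}, k ≤ m → c k ≤ c m := fun {k m} hkm => by
    rw [hc]; dsimp only
    have : (k : ℝ) ≤ m := by exact_mod_cast hkm
    have h1 : 1 / ((m : ℝ) + 2) ≤ 1 / ((k : ℝ) + 2) :=
      div_le_div_of_nonneg_left zero_le_one (by positivity) (by linarith)
    linarith
  have hnest : ∀ {k m : ℕ}, k ≤ m → Ioo (a k) (c k) ⊆ Ioo (a m) (c m) := fun hkm t ht =>
    ⟨(hanti hkm).trans_lt ht.1, ht.2.trans_le (hcmono hkm)⟩
  -- ## the window representatives and their agreement on overlaps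
  choose v hvc hvd hvm hvae using fun n =>
    oseenRep_window (hac n) (hweak.mono isOpen_Ioo fun t ht => ht.2.trans (hc0 n))
      (fun t ht x => hK t (ht.2.trans (hc0 n)) x) hI
      (fun t ht m hm => hMor t (ht.2.trans (hc0 n)) m hm)
  have hagree : ∀ k n, EqOn (uncurry (v k)) (uncurry (v n))
      ((Ioo (a k) (c k) ∩ Ioo (a n) (c n)) ×ˢ (univ : Set (EuclideanSpace ℝ (Fin 3)))) := by
    intro k n
    have hs1 : (Ioo (a k) (c k) ∩ Ioo (a n) (c n)) ×ˢ (univ : Set (EuclideanSpace ℝ (Fin 3))) ⊆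
        Ioo (a k) (c k) ×ˢ univ :=
      prod_mono inter_subset_left Subset.rfl
    have hs2 : (Ioo (a k) (c k) ∩ Ioo (a n) (c n)) ×ˢ (univ : Set (EuclideanSpace ℝ (Fin 3))) ⊆
        Ioo (a n) (c n) ×ˢ univ :=
      prod_mono inter_subset_right Subset.rfl
    refine Measure.eqOn_open_of_ae_eq (μ := (volume : Measure (ℝ × EuclideanSpace ℝ (Fin 3)))) ?_
      ((isOpen_Ioo.inter isOpen_Ioo).prod isOpen_univ) ((hvc k).mono hs1) ((hvc n).mono hs2)
    filter_upwards [ae_restrict_of_ae_restrict_of_subset hs1 (hvae k),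
      ae_restrict_of_ae_restrict_of_subset hs2 (hvae n)] with z hz1 hz2
    rw [← hz1, ← hz2]
  -- ## the index of a window containing a given negative time
  set idx : ℝ → ℕ := fun t => ⌈-t⌉₊ + ⌈1 / (-t)⌉₊ with hidxdef
  have hidx : ∀ t < 0, t ∈ Ioo (a (idx t)) (c (idx t)) := by
    intro t ht
    have ht0 : 0 < -t := neg_pos.2 ht
    have h1 : -t ≤ (⌈-t⌉₊ : ℝ) := Nat.le_ceil _
    have h2 : 1 / (-t) ≤ (⌈1 / (-t)⌉₊ : ℝ) := Nat.le_ceil _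
    have hk : ((idx t : ℕ) : ℝ) = (⌈-t⌉₊ : ℝ) + ⌈1 / (-t)⌉₊ := by
      rw [hidxdef]; dsimp only; rw [Nat.cast_add]
    have hn1 : (0 : ℝ) ≤ ⌈-t⌉₊ := Nat.cast_nonneg _
    have hn2 : (0 : ℝ) ≤ ⌈1 / (-t)⌉₊ := Nat.cast_nonneg _
    constructor
    · show -(((idx t : ℕ) : ℝ) + 2) < t
      rw [hk]; linarith
    · show t < -(1 / (((idx t : ℕ) : ℝ) + 2))
      rw [hk]
      have hpos : (0 : ℝ) < (⌈-t⌉₊ : ℝ) + ⌈1 / (-t)⌉₊ + 2 := by positivity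
      have hK' : 1 / (-t) < (⌈-t⌉₊ : ℝ) + ⌈1 / (-t)⌉₊ + 2 := by linarith
      rw [div_lt_iff₀ ht0] at hK'
      rw [lt_neg, div_lt_iff₀ hpos]
      linarith
  -- ## the representative
  set vg : ℝ → EuclideanSpace ℝ (Fin 3) → EuclideanSpace ℝ (Fin 3) := fun t x => v (idx t) t x with hvgdef
  have hloc : ∀ n, ∀ t ∈ Ioo (a n) (c n), ∀ x, vg t x = v n t x := fun n t ht x =>
    hagree (idx t) n (x := (t, x)) ⟨⟨hidx t (ht.2.trans (hc0 n)), ht⟩, mem_univ _⟩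
  -- `w = vg` a.e. on the slab
  have haew : ∀ᵐ z ∂(volume.restrict (Iio (0 : ℝ) ×ˢ (univ : Set (EuclideanSpace ℝ (Fin 3))))),
      uncurry w z = uncurry vg z := by
    have hcover : Iio (0 : ℝ) ×ˢ (univ : Set (EuclideanSpace ℝ (Fin 3))) ⊆
        ⋃ n, Ioo (a n) (c n) ×ˢ (univ : Set (EuclideanSpace ℝ (Fin 3))) :=
      fun z hz => mem_iUnion.2 ⟨idx z.1, hidx z.1 hz.1, mem_univ _⟩
    refine ae_restrict_of_ae_restrict_of_subset hcover ((ae_restrict_iUnion_iff _ _).2 fun n => ?_)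
    filter_upwards [hvae n, ae_restrict_mem (measurableSet_Ioo.prod MeasurableSet.univ)]
      with z hz hzI
    rw [hz]
    exact (hloc n z.1 hzI.1 z.2).symm
  have hvgc : ContinuousOn (uncurry vg) (Iio 0 ×ˢ univ) := by
    rintro ⟨t, x⟩ ⟨ht, -⟩
    have hW : Ioo (a (idx t)) (c (idx t)) ×ˢ (univ : Set (EuclideanSpace ℝ (Fin 3))) ∈ 𝓝 (t, x) :=
      (isOpen_Ioo.prod isOpen_univ).mem_nhds ⟨hidx t ht, mem_univ _⟩
    have heq : EqOn (uncurry vg) (uncurry (v (idx t))) (Ioo (a (idx t)) (c (idx t)) ×ˢ univ) :=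
      fun z hz => hloc (idx t) z.1 hz.1 z.2
    exact (((hvc (idx t)).congr heq).continuousAt hW).continuousWithinAt
  refine ⟨vg, haew, hvgc, fun t ht => hvd (idx t) t (hidx t ht), fun s t hst ht x => ?_,
    fun t ht x => ?_⟩
  · -- the Oseen identity, inside one window containing `s` and `t`
    have hs : s < 0 := hst.trans ht
    set m : ℕ := max (idx s) (idx t) with hm
    have hsW : s ∈ Ioo (a m) (c m) := hnest (le_max_left _ _) (hidx s hs)
    have htW : t ∈ Ioo (a m) (c m) := hnest (le_max_right _ _) (hidx t ht)
    have e2 : vg s = v m s := funext (hloc m s hsW)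
    have e3 : oseenDuhamel 1 s vg vg t x = oseenDuhamel 1 s (v m) (v m) t x := by
      simp only [oseenDuhamel_apply]
      refine setIntegral_congr_fun measurableSet_Ioo fun σ hσ => ?_
      have e : vg σ = v m σ := funext (hloc m σ ⟨hsW.1.trans hσ.1, hσ.2.trans htW.2⟩)
      rw [e]
    rw [hloc m t htW x, e2, e3]
    exact hvm m s t hsW.1 hst htW.2 x
  · -- the bound passes from `w` (a.e.) to the continuous `vg` (everywhere)
    have hgc : ContinuousOn (fun z : ℝ × EuclideanSpace ℝ (Fin 3) => max ‖vg z.1 z.2‖ K)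
        (Iio 0 ×ˢ univ) :=
      continuous_max.comp_continuousOn (hvgc.norm.prodMk continuousOn_const)
    have hg0 : (fun z : ℝ × EuclideanSpace ℝ (Fin 3) => max ‖vg z.1 z.2‖ K)
        =ᵐ[volume.restrict (Iio (0 : ℝ) ×ˢ univ)] fun _ => K := by
      filter_upwards [haew, ae_restrict_mem (measurableSet_Iio.prod MeasurableSet.univ)]
        with z hz hzI
      have e : vg z.1 z.2 = w z.1 z.2 := (show uncurry w z = uncurry vg z from hz).symm
      show max ‖vg z.1 z.2‖ K = K
      rw [e]
      exact max_eq_right (hK z.1 hzI.1 z.2)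
    exact max_eq_right_iff.1 (Measure.eqOn_open_of_ae_eq hg0 (isOpen_Iio.prod isOpen_univ) hgc
      continuousOn_const (x := (t, x)) ⟨ht, mem_univ _⟩)

/-- **Stub `stub_oseenRepresentative`** (KNSS 2009, Lemma 3.1 / §4 (i); Albritton–Barker 2019, §3
pattern). A bounded ancient mild solution (`ν = 1`, duality form) with measurable slices and
pointwise Type I decay has a representative `v`, continuous on the open past `(−∞, 0) × ℝ³`,
bounded, with weakly divergence-free slices, solving the Oseen integral equation
`v(t) = e^{(t−s)Δ}v(s) − B¹ₛ(v, v)(t)` pointwise for all `s < t < 0`, and equal to `u(t)` a.e. in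
space for a.e. `t < 0` (module docstring, steps 1–4). -/
theorem stub_oseenRepresentative :
    ∀ u : ℝ → EuclideanSpace ℝ (Fin 3) → EuclideanSpace ℝ (Fin 3),
      IsBoundedAncientMildSolution 1 u →
      (∀ t < 0, AEStronglyMeasurable (u t) volume) → (∃ C : ℝ, HasTypeIDecay C u) →
      ∃ v : ℝ → EuclideanSpace ℝ (Fin 3) → EuclideanSpace ℝ (Fin 3),
        ContinuousOn (Function.uncurry v) (Iio 0 ×ˢ univ) ∧
        (∃ M : ℝ, ∀ t < 0, ∀ x, ‖v t x‖ ≤ M) ∧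
        (∀ t < 0, IsWeaklyDivFree (v t)) ∧
        (∀ s t : ℝ, s < t → t < 0 → ∀ x,
          v t x = Literature.Analysis.UnboundedOperators.heatExtension (v s) (t - s) x - oseenDuhamel 1 s v v t x) ∧
        (∀ᵐ t ∂(volume.restrict (Iio (0 : ℝ))), v t =ᵐ[volume] u t) := by
  intro u hu hmeas hdec
  obtain ⟨C, hC⟩ := hdec
  obtain ⟨M, hM'⟩ := hu.2
  have hM : ∀ t < 0, ∀ x, ‖u t x‖ ≤ M := fun t ht x => hM' t ht x
  have hC0 : 0 ≤ C := by
    have h := hC (-1) (by norm_num) 0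
    rw [norm_zero, zero_add, neg_neg, Real.sqrt_one, div_one] at h
    exact (norm_nonneg _).trans h
  -- ## Step 1: weak-* continuity, jointly measurable bounded modification `w`
  have hCr : ∀ t < 0, ∀ x, cylRadius x * ‖u t x‖ ≤ C := by
    intro t ht x
    have hs : 0 < Real.sqrt (-t) := Real.sqrt_pos.2 (neg_pos.2 ht)
    have hden : 0 < ‖x‖ + Real.sqrt (-t) := by positivity
    calc cylRadius x * ‖u t x‖ ≤ ‖x‖ * (C / (‖x‖ + Real.sqrt (-t))) :=
          mul_le_mul (SereginSverak2009.cylRadius_le_norm' x) (hC t ht x) (norm_nonneg _)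
            (norm_nonneg _)
      _ ≤ (‖x‖ + Real.sqrt (-t)) * (C / (‖x‖ + Real.sqrt (-t))) :=
          mul_le_mul_of_nonneg_right (le_add_of_nonneg_right hs.le) (div_nonneg hC0 hden.le)
      _ = C := by field_simp
  have hws : ∀ θ : EuclideanSpace ℝ (Fin 3) → EuclideanSpace ℝ (Fin 3),
      Literature.Analysis.FunctionSpaces.IsTestFunctionOn (⊤ : Opens (EuclideanSpace ℝ (Fin 3))) θ →
      ContinuousOn (fun t => ∫ x, ⟪u t x, θ x⟫) (Iio 0) := fun θ hθ =>
    continuousOn_integral_inner_of_cylRadius_decay hM hmeas hu.1.1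
      (fun φ hφ hdiv => hu.continuousOn_integral_inner one_pos hmeas hφ hdiv) hCr hθ
  obtain ⟨w₀, hw₀, hw₀u⟩ := exists_stronglyMeasurable_modification hM hmeas hws
  obtain ⟨w, hw, hwu, hwM⟩ :=
    exists_bounded_modification (μ := volume) hM hw₀.aestronglyMeasurable hw₀u
  have hwcl : IsBoundedAncientMildSolution 1 w :=
    hu.congr_ae_slice hwu ⟨max M 0, fun t _ x => hwM t x⟩
  have hwmeas : ∀ t < 0, AEStronglyMeasurable (w t) volume := fun t ht =>
    (hmeas t ht).congr (hwu t ht).symm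
  -- ## Step 2: mild ⇒ weak
  have hweak : IsBoundedWeakNSSolutionOn (Iio 0) isOpen_Iio 1 w :=
    hwcl.isBoundedWeakNSSolutionOn one_pos hw.restrict hwmeas
  -- the Morrey bound on every slice of `w`
  have hMor : ∀ t < 0, ∀ m : ℕ, 1 ≤ m →
      ∫⁻ y in ball (0 : EuclideanSpace ℝ (Fin 3)) m, ‖w t y‖ₑ ^ 2 ≤
        ENNReal.ofReal (4 * Real.pi * C ^ 2 * m) := by
    intro t ht m hm
    have e : ∫⁻ y in ball (0 : EuclideanSpace ℝ (Fin 3)) m, ‖w t y‖ₑ ^ 2 = ∫⁻ y in ball 0 m, ‖u t y‖ₑ ^ 2 :=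
      lintegral_congr_ae (ae_restrict_of_ae ((hwu t ht).mono fun y hy => by
        show ‖w t y‖ₑ ^ 2 = ‖u t y‖ₑ ^ 2
        rw [hy]))
    rw [e]
    refine oseenRep_lintegral_ball_sq_le (fun y hy => ?_) (by exact_mod_cast hm)
    have hs : 0 < Real.sqrt (-t) := Real.sqrt_pos.2 (neg_pos.2 ht)
    exact (hC t ht y).trans
      (div_le_div_of_nonneg_left hC0 (norm_pos_iff.2 hy) (le_add_of_nonneg_right hs.le))
  -- ## Steps 3–4: window representatives, glued
  obtain ⟨v, hvae, hvc, hvd, hvm, hvK⟩ :=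
    oseenRep_ancient hweak (fun t _ x => hwM t x) (by positivity : (0 : ℝ) ≤ 4 * Real.pi * C ^ 2) hMor
  refine ⟨v, hvc, ⟨max M 0, hvK⟩, hvd, hvm, ?_⟩
  -- Fubini: a.e. on the slab ⇒ a.e. in space at a.e. time; and `w(t) = u(t)` a.e. for every `t`
  have h1 : ∀ᵐ t ∂(volume.restrict (Iio (0 : ℝ))), ∀ᵐ x ∂(volume : Measure (EuclideanSpace ℝ (Fin 3))),
      uncurry w (t, x) = uncurry v (t, x) := by
    rw [Measure.volume_eq_prod, ← Measure.restrict_prod_eq_prod_univ] at hvae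
    exact Measure.ae_ae_of_ae_prod hvae
  filter_upwards [h1, ae_restrict_mem measurableSet_Iio] with t ht htI
  filter_upwards [ht, hwu t htI] with x hx hx'
  simp only [uncurry] at hx
  rw [← hx, hx']

end Summit.NavierStokesRegularity.NavierStokesRegularity.Theorems.NoSelfExcitedDynamo.Registered

end
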